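import Mathlib
import HarnessLib
import HarnessLib.Audit
import Summits.PneNP.Statement
import Literature.Probability.RandomGraphs.PlantedClique
import Literature.Computability.Complexity.Circuit
import Literature.Computability.Complexity.NegationElimination

/-!
Route: KarlinRubin

CLOSED (retired) 2026-08-17T16:17:09Z by planner-rbadge-PneNP-KarlinRubin-71600670-g2-0 — reason: tribunal-failed:summit-strength (rule a, kernel-final): MonotoneSuffices ⇐ PlantedCliqueQuasipolyHard with plantedCliqueQuasipolyHard_implies_PneNP landed; no honest repair (CLOSE-CENSUS.md §3); no partner crux for MonotoneBlind short of S — note: route-repair g2 (rbadge 71600670): RETIRED on tribunal FAIL summit-strength, kernel-final (t0 2026-08-17T15:32Z): MonotoneSuffices ⇐ PlantedCliqueQuasipolyHard by `karlinRubin_monotoneSuffices_of_quasipolyHard` (5 ms) with bridge `plantedCliqueQuasipolyHard_implies_PneNP` LANDED (rule (a)). Anatomy:. The file is kept as the record of this route; refuted decls are indexed as negative knowledge (`ledger negatives`).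

# Route KarlinRubin — planted cliques are monotone-complete and monotone-hard below the square root

It suffices to show X = X₁ ∧ X₂ for the planted-clique detection problem at density 1/2 (distinguish
G(n,1/2) ∪ K_A, |A| = ⌈n^(1/2−δ)⌉, from G(n,1/2) with type-I + type-II error → 0, in the vocabulary
of Literature/Probability/RandomGraphs/PlantedClique.lean and the straight-line circuits of
Literature/Computability/Complexity/Circuit.lean). X₁ (MonotoneSuffices, "computational
Karlin–Rubin"): for every δ ∈ (0,1/2) there is an exponent a such that whenever SOME family of
fan-in-2 Boolean circuits of size ≤ s(n) strongly detects the planted ⌈n^(1/2−δ)⌉-clique, some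
family of MONOTONE circuits over {∧₂, ∨₂, 0, 1} of size ≤ (s(n)+n)^a does too. X₂ (MonotoneBlind):
for every δ ∈ (0,1/2) no polynomial-size monotone family strongly detects it. Neither conjunct
mentions P or NP; X₁ is a model-simulation statement, X₂ a restricted-model lower bound.
Lean: `(∀ δ : ℝ, 0 < δ → δ < 1 / 2 → ∃ a : ℕ, ∀ s : ℕ → ℕ, (∃ C : (n : ℕ) →
Literature.Computability.Complexity.Circuit ((⊤ : SimpleGraph (Fin n)).edgeSet), (∀ᶠ n : ℕ in
Filter.atTop, (C n).IsOver Literature.Computability.Complexity.B2 ∧ (C n).size ≤ s n) ∧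
Filter.Tendsto (fun n : ℕ => (Literature.Probability.RandomGraphs.PlantedClique.erdosRenyiHalf
n).toOuterMeasure {x | (C n).eval x = true} +
(Literature.Probability.RandomGraphs.PlantedClique.plantedCliqueDist n ⌈(n : ℝ) ^ (1 / 2 -
δ)⌉₊).toOuterMeasure {x | (C n).eval x = false}) Filter.atTop (nhds 0)) → ∃ C' : (n : ℕ) →
Literature.Computability.Complexity.Circuit ((⊤ : SimpleGraph (Fin n)).edgeSet), (∀ᶠ n : ℕ in
Filter.atTop, (C' n).IsOver Literature.Computability.Complexity.monotoneBasis01 ∧ (C' n).size ≤ (s n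
+ n) ^ a) ∧ Filter.Tendsto (fun n : ℕ =>
(Literature.Probability.RandomGraphs.PlantedClique.erdosRenyiHalf n).toOuterMeasure {x | (C' n).eval
x = true} + (Literature.Probability.RandomGraphs.PlantedClique.plantedCliqueDist n ⌈(n : ℝ) ^ (1 / 2
- δ)⌉₊).toOuterMeasure {x | (C' n).eval x = false}) Filter.atTop (nhds 0)) ∧ (∀ δ : ℝ, 0 < δ → δ < 1
/ 2 → ∀ c : ℕ, ¬ ∃ C : (n : ℕ) → Literature.Computability.Complexity.Circuit ((⊤ : SimpleGraph (Fin
n)).edgeSet), (∀ᶠ n : ℕ in Filter.atTop, (C n).IsOver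
Literature.Computability.Complexity.monotoneBasis01 ∧ (C n).size ≤ n ^ c) ∧ Filter.Tendsto (fun n :
ℕ => (Literature.Probability.RandomGraphs.PlantedClique.erdosRenyiHalf n).toOuterMeasure {x | (C
n).eval x = true} + (Literature.Probability.RandomGraphs.PlantedClique.plantedCliqueDist n ⌈(n : ℝ)
^ (1 / 2 - δ)⌉₊).toOuterMeasure {x | (C n).eval x = false}) Filter.atTop (nhds 0))`

## Assembly
Deciding theorem `closes (hSim : MonotoneSuffices) (hLB : MonotoneBlind) (hE :
ErdosRenyiNoLargeClique) (hBridge : CliqueCircuitsOfNotPneNP) : PneNP` (rev 1, route-repair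
2026-08-17; 145 lines, sorry-free, natively certified, axioms propext/Classical.choice/Quot.sound):
by contradiction, ¬PneNP and the bridge support hBridge (= NP ⊆ P/poly read through Karp:
B₂-circuits of size ≤ n^c₁ computing CLIQUE(n, t) for ALL t ≤ n eventually — provable now in two
lines from exists_circuit_cliqueFn_of_NP_subset_PPoly ∘ NP_subset_PPoly_of_not_pneNP of
Summits.PneNP.PneNP.Theorems.ConvexRankGatesCliqueBridgeTerm, which at rev 0 was IMPORTED for this
step; filing it as an item lets the route file import only PlantedClique + Circuit +
NegationElimination, shedding CliqueTestGraphs → CircuitLowerBounds.lean and its unproved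
Murray–Williams named facts, used by no item); with t(n) = 3⌊log₂ n⌋ + 3 (so 3 log₂ n ≤ t(n) ≤
⌈n^(1/4)⌉ ≤ n eventually, proved inline from isLittleO_log_rpow_atTop) the family strongly detects
the planted ⌈n^(1/4)⌉-clique: type-II error is 0 eventually (the planted clique contains a
t(n)-clique, mem_support_plantedCliqueJoint) and type-I error → 0 by hE; MonotoneSuffices at δ = 1/4
turns it into a monotone family of size ≤ (n^c₁ + n)^a ≤ n^(a(c₁+2)), contradicting MonotoneBlind at
δ = 1/4, c = a(c₁+2). The Assembly item is literally the type of `closes`.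

Rationale: WHY THIS LINE. The planted pair is STOCHASTICALLY ORDERED: its likelihood ratio L(x) =
E_A[2^C(k,2)·1[K_A ⊆ x]] is a nonnegative combination of clique indicators (the planting identity
E[g(x ∪ K_A)] = E[L·g] is proved in-tree,
Literature.Computability.Complexity.GnpPlantedLikelihoodRatio), so the Neyman–Pearson test is
monotone, every known detector in every regime is a threshold of monotone statistics (degree
thresholds from k ≥ C√(n log n), Kucera1995; counts of high-degree vertices and core peeling at k =
Θ(√n), AlonKrivelevichSudakov1998 / Dekel–Gurel-Gurevich–Peres; "guess t = 2δ log₂ n clique vertices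
and test degrees in the common neighbourhood" below √n, a monotone circuit of size n^(2δ log₂ n +
O(log log n))), and monotone tests are exactly the tests robust to the benign semirandom adversary
(FeigeKrauthgamer2003). X₁ elevates this to a simulation principle with separately refutable
content; the hypothesis is load-bearing: for the BARE pair (isolated K_A versus G(n,1/2), not
stochastically ordered) non-monotone poly-size circuits win by sparsity (edge count) while monotone
circuits need size n^ω(1) for |A| ≤ n/2^ω(√log n) (BlasiokMeierhofer2025 = arXiv:2501.09545, Thms
1.3–1.4, Jan 2025). X₂ is the monotone shadow of the Planted Clique conjecture and is OPEN:
Rossman2010/Rossman2014 and CavalarKumarRossman2022 treat bare positives against sparse threshold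
noise, arXiv:2501.09545 bare positives against G(n,1/2), arXiv:2311.04204 (GamarnikMosselZadik2023)
AC⁰ for a dense variant; NOISY positives at p = 1/2 break the one-sided error accounting of
Razborov's approximation method (the (1/2)-biased clique-sunflower term budget 2^Θ(ℓ²) meets
discarded terms that noise alone satisfies with probability 2^(−C(t,2))), so the attack books errors
as ADVANTAGE (noise-only firings cancel) and ends in a narrow-DNF blindness lemma proved by second
moments — tools all in the tree (RossmanMonotoneClique*, GnpPlantedLikelihoodRatio,
CliqueApproximators). Imported areas: mathematical statistics (Karlin–Rubin: for
monotone-likelihood-ratio families the UMP test is monotone; contiguity/second moment), extremal set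
theory (robust/clique sunflowers, arXiv:2012.03883), random graphs. Versus the listed routes:
PlantedClique carries the detection conjecture as ONE summit-hard leaf with a low-degree transfer
crux; here it is the proved assembly node of two non-summit leaves with a different mechanism
(monotone circuits, not low-degree polynomials); OneSlice and ConvexRankGates prove monotone CLIQUE
lower bounds worst-case / on critical slices and transfer by Berkowitz or by extended gates — here
the distribution is G(n,1/2) with planted positives, the transfer is a distribution-specific
simulation conjecture, and no worst-case monotone-to-general transfer (refuted by Tardos1988) is
used.

RANKED CRUXES. #2 MonotoneSuffices (crux) — for every δ ∈ (0,1/2) there is a : ℕ such that for every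
size budget s : ℕ → ℕ, if some family of B₂-circuits on the edges of Kₙ, of size ≤ s(n) eventually,
has G(n,1/2)-acceptance probability plus planted-⌈n^(1/2−δ)⌉-clique rejection probability → 0, then
some family of circuits over {∧₂,∨₂,0,1} of size ≤ (s(n)+n)^a eventually has the same error sum → 0.
Non-vacuous (the monotone (3 log₂ n)-clique search of size n^(3 log₂ n) instantiates the conclusion
for large s), consistent with every known algorithm, and refutable by any single circuit family.
[difficulty: open-problem] (why it might fail: a Tardos phenomenon on average: some non-monotone
statistic (signed spectral norm, GF(2)-rank of neighbourhood patterns) could strongly detect at a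
budget where all monotone circuits provably fail; no monotonisation procedure for general circuits
is known.) [Tardos1988, Razborov1985, arXiv:2501.09545, FeigeKrauthgamer2003,
AlonKrivelevichSudakov1998, Kucera1995, Jerrum1992]
#3 MonotoneBlind (crux) — for every δ ∈ (0,1/2) and every c : ℕ there is NO family of circuits over
{∧₂,∨₂,0,1} on the edges of Kₙ with size ≤ n^c eventually whose G(n,1/2)-acceptance probability plus
planted-⌈n^(1/2−δ)⌉-clique rejection probability tends to 0 (monotone circuits of polynomial size
cannot strongly detect planted cliques below √n; the truth is conjecturally n^Θ(δ log n), attained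
by guess-and-verify). [difficulty: L] (why it might fail: only poly-vs-quasipoly room (a monotone
detector of size n^(2δ log₂ n + O(log log n)) exists); noise breaks Razborov's one-sided accounting
at p = 1/2, and an iterated-threshold monotone statistic might strongly detect at k = n^(1/2−δ)
after all.) [arXiv:2501.09545, Rossman2010, CavalarKumarRossman2022, AlonBoppana1987, Razborov1985,
arXiv:2311.04204, BarakHopkinsKelnerKothariMoitraPotechin2019, Jerrum1992]
#9 ErdosRenyiNoLargeClique (support) — first-moment clique bound for G(n,1/2): if k(n) ≥ (2+η) log₂
n eventually for some η > 0 then Pr[G(n,1/2) has a k(n)-clique] → 0. Verbatim the PROVED item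
stmt-PneNP-8686 of route PlantedClique (Theorems/PlantedCliqueErdosRenyiNoLargeClique.lean,
plantedClique_erdosRenyiNoLargeClique_proof); it is the type-I half of the clique test inside the
deciding theorem. [difficulty: provable-now] [AlonKrivelevichSudakov1998,
BarakHopkinsKelnerKothariMoitraPotechin2019, Jerrum1992]
#9 CliqueCircuitsOfNotPneNP (support, rev 1) — BRIDGE: ¬PneNP → ∃ c, for all large n and EVERY t ≤ n
a B₂-circuit with ≤ n^c gates computes CLIQUE(n, t) (the clique function written inline, rfl-equal
to Literature.Computability.Complexity.cliqueFn n t). PROVABLE NOW, two lines — `fun hne =>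
exists_circuit_cliqueFn_of_NP_subset_PPoly (NP_subset_PPoly_of_not_pneNP hne)`
(Summits.PneNP.PneNP.Theorems.ConvexRankGatesCliqueBridgeTerm; planner evidence BridgeProof.lean on
stmt-PneNP-18051, lean check rc 0). Filed as an ITEM (route-repair, cone) instead of an import: the
bridge module imports CliqueTestGraphs → CircuitLowerBounds.lean, the home of cliqueFn and of the
unproved XL named facts MurrayWilliams2018_NQP_not_ACC / MurrayWilliams2018_NTIME_not_depth_ACC,
which NO item of this route uses (needs-fact: none) but which kept the route unstaffed; the route
file now imports PlantedClique + Circuit + NegationElimination only (import closure 107 → 11 project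
modules). Prover: state it against the route decl in a Theorems file importing this route file and
the bridge module (closure linked by docstring); same mathematics as the PROVED CliqueBridge of
route ConvexRankGates (stmt-PneNP-10683), uniform in t ≤ n. [difficulty: provable-now] [Karp1972,
AroraBarak2009]

TWO-LAYER PLAN. MonotoneBlind ⇐ NarrowDnfApprox → NarrowDnfBlind → MonotoneBlind (the registered
birth skeleton bc/MonotoneBlind_birth.lean: (1/2)-biased clique-sunflower approximation in advantage
accounting; blindness of ORs of ≤ 2^(ℓ²) clique-indicators of ≤ ℓ-sets, ℓ ≤ ½ log₂ n, by second
moments). MonotoneSuffices ⇐ PtfNormalForm → ThresholdSynthesis → MonotoneSuffices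
(bc/MonotoneSuffices_birth.lean: efficient strong detectors are monotone polynomial threshold tests
with polynomially many monomials; monotone sorting-network synthesis of threshold-of-ANDs, a theorem
in kind). A weaker fallback for MonotoneSuffices, if the family form dies: the collapse form "CLIQUE
∈ P ⇒ polynomial-size monotone detectors" (strictly weaker, same assembly).

KILL CRITERIA. MonotoneSuffices refuted — a circuit family (of any size s) strongly detecting the
planted ⌈n^(1/2−δ)⌉-clique together with a monotone lower bound beyond (s+n)^a for every a — closes
the route `refuted:MonotoneSuffices` and lands a "Tardos-on-average" theorem (new barrier entry for
every monotone-capture line, incl. ConvexRankGates and OneSlice). A refutation in a NEIGHBOURING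
OR-channel problem (same shape, other planted structure) forces a pivot to the collapse form of the
two-layer plan. MonotoneBlind refuted = a polynomial-size monotone strong detector below √n: refutes
the monotone (hence the nonuniform) Planted Clique conjecture — close `refuted:MonotoneBlind`, and
route PlantedClique dies with it. PlantedcliqueDetectionHard proved elsewhere moots both cruxes
(PneNP follows by PlantedClique's closes); P ≠ NP proved elsewhere moots the route.

NOT DECOMPOSED YET. The parameters of the narrow-DNF approximation (term budget M(n) ≤ 2^(ℓ(n)²),
width ℓ(n) ≤ ½ log₂ n, plucking threshold ε = n^(−log n)) and the exact form of the
advantage-accounting lemma; the monotone threshold-synthesis constant; the k = Θ(√n) window (whether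
monotone circuits strongly detect at k = C√n for fixed C, where the spectral test does and iterated
degree thresholds give only constant error) — informative for MonotoneSuffices but outside both
cruxes (δ > 0 strictly); uniform versions (P-uniform monotone families).

CHEAPEST FALSIFIER. For MonotoneSuffices: the k = C√n window just named — compute (kit, n ≤ 4000)
the error of the best 3-round iterated degree-threshold monotone statistic versus the top eigenvalue
of the ±1 adjacency matrix at k = 2√n; if the monotone error plateaus while the spectral error
vanishes, the "monotone suffices" principle already fails one log-factor above the window and the
crux should be restated with a polylog slack in k (not run this session: the claim inside the window
δ > 0 is untouched by it, recorded as the first refuter task). For MonotoneBlind: literature lookup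
(run) — no monotone lower bound for NOISY planted clique at p = 1/2 exists (arXiv:2501.09545 treats
bare cliques; Rossman2010/CKR threshold noise; arXiv:2311.04204 AC⁰ dense variant); in-Lean: the
degenerate cases k ≤ n automatically (⌈n^(1/2−δ)⌉ ≤ n for n ≥ 1) and the vacuity audit (errSum = 1
identically when the planted set is a single vertex) passed by inspection.

NUMBERS. Planted clique at p = 1/2, k = n^(1/2−δ): information threshold 2 log₂ n; polynomial time
from k ≥ c√n (AlonKrivelevichSudakov1998, proved in-tree as aks_recovery_holds); degree test from k
≥ C√(n log n) (Kucera1995); below √n: best algorithms n^(2δ log₂ n + O(1)) (guess-and-spectral),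
monotone n^(2δ log₂ n + O(log log n)) (guess-and-degree), brute force n^(3 log₂ n); restricted lower
bounds below √n: Metropolis (Jerrum1992), SQ (arXiv:1201.1214), SoS degree d for k ≤ n^(1/2 −
c√(d/log n)) (BarakHopkinsKelnerKothariMoitraPotechin2019), low-degree D = o(log² n) (Hopkins2018);
monotone vs bare K_A at p = 1/2: size n^Ω(δ²log n) needed iff |A| ≤ n/2^ω(√log n) (arXiv:2501.09545
Thm 1.3/1.4; Cor. 1.5: monotone CLIQUE_k needs n^Ω(δ²k) for k ≤ n^(1/2−δ)/log² n); AC⁰: depth-d size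
exp(k^(1/d)) for the dense planted variant, (log n)^ω(1) = k ≤ n^(1/3−ε) (arXiv:2311.04204 Thm 1.7).
Items at open: 4 (2 crux, 1 support (proved elsewhere), 1 assembly). Rev 1 (route-repair, cone,
2026-08-17): 5 items (2 crux, 2 support — both provable now —, 1 assembly = the type of `closes`);
imports PlantedClique, Circuit, NegationElimination.

DEFINITION REQUESTS. None. All statements are over existing declarations:
Literature.Computability.Complexity.Circuit (IsOver, size, eval, B2, monotoneBasis01),
Literature.Probability.RandomGraphs.PlantedClique (erdosRenyiHalf, plantedCliqueDist,
graphOfEdgeVec), PMF.toOuterMeasure. Cite fact wanted (not blocking): BlasiokMeierhofer2025 Thm 1.3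
as a named Literature fact `Literature.Computability.Complexity.BlasiokMeierhofer2025_thm_1_3`
(bare-clique monotone gap at p = 1/2), the special case in kind of MonotoneBlind.

Novelty: Searches (2026-08-17): `lit frontier PneNP --since 2024` (30 rows; none on monotone planted clique);
`lit search --source arxiv "planted clique monotone"` (4: arXiv:2311.04204, arXiv:2501.09545, 2
irrelevant); `lit search --source arxiv "monotone circuit clique random graphs"` (2: same two); `lit
search --source zbmath "Rossman clique"` (9: Rossman2010/2014, CKR22, Amano 2010, …); `lit galaxy
search "planted clique" --star all` (30 rows: semirandom lower bound arXiv:1704.05120,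
detection-recovery gaps, SoS notes — no monotone-circuit entry); `lit galaxy read
pdf:816278560300449780` (CKR22 full text: positives = bare K_A, negatives = G(n,p) at threshold p);
`lit read arxiv:2501.09545` (pp. 1–4, 21–22: bare β-clique vs G(n,p), p = n^(−2/(α−1)), tight at p =
1/2), `lit read arxiv:2311.04204` (pp. 2–8, 15, 20: AC⁰, dense variant, p_IT → 1); `lean search`
over Literature (RossmanMonotoneClique*, GnpPlantedLikelihoodRatio, PlantedClique*: Rossman 2010 Thm
1 finite forms and second-moment planting tools, nothing at p = 1/2 with noisy positives); the 52
open route headers and 172 idea cards (no monotone × planted-clique entry; nearest cards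
parity-blind-refuters-feige-ladder, erdos-objects-certification-natural-proofs).
Nearest prior art found: arXiv:2501.09545 (BlasiokMeierhofer2025: monotone circuits vs BARE cliques
at p = 1/2, tight threshold n/2^Θ(√log n)); Rossman2010 + CavalarKumarRossman2022 (bare K_A vs
threshold-density noise); arXiv:2311.04204 (AC⁰ for a dense planted varia  [refs: 2311.04204, 2501.09545, 1704.05120, arxiv:2501.09545, arxiv:2311.04204, Rossman2010, BlasiokMeierhofer2025, CavalarKumarRossman2022]

Barriers (technique_class: monotone-simulation, approximation-method, planted-clique): - technique_class: monotone-simulation, approximation-method, planted-clique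
- Literature.Barriers.PneNP.MonotoneGap: Tardos's ϑ-function refutes WORST-CASE monotone-to-general
transfer; this line transfers only on one distribution pair where ϑ is provably blind below √n
(FeigeKrauthgamer2003) and where the likelihood ratio is monotone; the bare-clique counterexample
(edge count vs arXiv:2501.09545) is excluded by exactly that hypothesis — the bet is that stochastic
order removes the Tardos phenomenon.
- Literature.Barriers.PneNP.NegationLimitedGapSingleOutput: clique-like-generic negation-limited
bounds are attained by functions in P; MonotoneBlind is not a bound for a function class but for a
distributional task on which those P-functions (ϑ thresholds) fail, and no negation budget is
transferred.
- Literature.Barriers.PneNP.NegationLimitedGapSingleOutputSqrtLog: kills clique-like-GENERIC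
negation-limited lower bounds up to Θ(√(log n)/log log n) NOT gates (they are attained by Tardos's
feasible ϑ-threshold); MonotoneBlind transfers no negation budget and is proved — if at all — by a
property of CLIQUE beyond clique-likeness that the entry itself lists as uncovered: rejection of
Erdős–Rényi graphs G(n,1/2) below the ϑ-certification threshold √n, where ϑ-type functions are not
detectors (FeigeKrauthgamer2003); MonotoneSuffices is a simulation claim on that distribution pair,
not a monotone-to-general inference.
- Literature.Barriers.PneNP.NegationLimitedGap: the multi-output

History (route lifecycle, newest last):
- 2026-08-17T07:18:35Z · rev 2: restated Assembly (stmt-PneNP-18029) — route-repair (cone) step 2/2, text + Assembly: Assembly restated to the rev-1 type of `closes` (adds the bridge hypothesis CliqueCircuitsOfNotPneNP); thesis ## (planner-rrepair-PneNP-KarlinRubin-71600670-0)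
- 2026-08-17T16:17:09Z · CLOSED retired — tribunal-failed:summit-strength (rule a, kernel-final): MonotoneSuffices ⇐ PlantedCliqueQuasipolyHard with plantedCliqueQuasipolyHard_implies_PneNP landed; no honest repair (CLOSE-CENSUS.md §3); no pa (planner-rbadge-PneNP-KarlinRubin-71600670-g2-0)

sub-problem: PneNP · status: closed(retired) · opened planner-plan-novel-PneNP-PneNP-1b2e912a-v2-g16-0 2026-08-17T06:51:14Z · rev 3 · ledger route-PneNP-KarlinRubin
GENERATED by the gate from the ledger (D-0016/17). Provers cite these decls: `theorem foo : Summit.PneNP.PneNP.Theses.KarlinRubin.<Decl> := …` in Summits/PneNP/PneNP/Theorems/<Name>.lean.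
-/

namespace Summit.PneNP.PneNP.Theses.KarlinRubin

open scoped BigOperators Topology Manifold Classical MeasureTheory ProbabilityTheory Matrix InnerProductSpace ComplexConjugate ContinuousMap
open Filter Set Function TopologicalSpace MeasureTheory

attribute [summit_statement] _root_.PneNP

open Literature.PNP

/-- item stmt-PneNP-18026 · crux · rank 2 · closed · moot by None · by planner
why it might fail: a Tardos phenomenon on average: some non-monotone statistic (signed spectral norm, GF(2)-rank of neighbourhood patterns) could strongly detect at a budget where all monotone circuits provably fail; no monotonisation procedure for general circuits is known.
sources: Tardos1988, Razborov1985, arXiv:2501.09545, FeigeKrauthgamer2003, AlonKrivelevichSudakov1998, Kucera1995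
[crux] for every δ ∈ (0,1/2) there is a : ℕ such that for every size budget s : ℕ → ℕ, if some
family of B₂-circuits on the edges of Kₙ, of size ≤ s(n) eventually, has G(n,1/2)-acceptance
probability plus planted-⌈n^(1/2−δ)⌉-clique rejection probability → 0, then some family of circuits
over {∧₂,∨₂,0,1} of size ≤ (s(n)+n)^a eventually has the same error sum → 0. Non-vacuous (the
monotone (3 log₂ n)-clique search of size n^(3 log₂ n) instantiates the conclusion for large s),
consistent with every known algorithm, and refutable by any single circuit family. [difficulty:
open-problem] -/
@[route_item "route-PneNP-KarlinRubin"]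
def MonotoneSuffices : Prop :=
  ∀ δ : ℝ, 0 < δ → δ < 1 / 2 → ∃ a : ℕ, ∀ s : ℕ → ℕ, (∃ C : (n : ℕ) → Literature.Computability.Complexity.Circuit ((⊤ : SimpleGraph (Fin n)).edgeSet), (∀ᶠ n : ℕ in Filter.atTop, (C n).IsOver Literature.Computability.Complexity.B2 ∧ (C n).size ≤ s n) ∧ Filter.Tendsto (fun n : ℕ => (Literature.Probability.RandomGraphs.PlantedClique.erdosRenyiHalf n).toOuterMeasure {x | (C n).eval x = true} + (Literature.Probability.RandomGraphs.PlantedClique.plantedCliqueDist n ⌈(n : ℝ) ^ (1 / 2 - δ)⌉₊).toOuterMeasure {x | (C n).eval x = false}) Filter.atTop (nhds 0)) → ∃ C' : (n : ℕ) → Literature.Computability.Complexity.Circuit ((⊤ : SimpleGraph (Fin n)).edgeSet), (∀ᶠ n : ℕ in Filter.atTop, (C' n).IsOver Literature.Computability.Complexity.monotoneBasis01 ∧ (C' n).size ≤ (s n + n) ^ a) ∧ Filter.Tendsto (fun n : ℕ => (Literature.Probability.RandomGraphs.PlantedClique.erdosRenyiHalf n).toOuterMeasure {x | (C' n).eval x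 = true} + (Literature.Probability.RandomGraphs.PlantedClique.plantedCliqueDist n ⌈(n : ℝ) ^ (1 / 2 - δ)⌉₊).toOuterMeasure {x | (C' n).eval x = false}) Filter.atTop (nhds 0)

/-- item stmt-PneNP-18027 · crux · rank 3 · closed · moot by None · by planner
why it might fail: only poly-vs-quasipoly room (a monotone detector of size n^(2δ log₂ n + O(log log n)) exists); noise breaks Razborov's one-sided accounting at p = 1/2, and an iterated-threshold monotone statistic might strongly detect at k = n^(1/2−δ) after all.
sources: arXiv:2501.09545, Rossman2010, CavalarKumarRossman2022, AlonBoppana1987, Razborov1985, arXiv:2311.04204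
[crux] for every δ ∈ (0,1/2) and every c : ℕ there is NO family of circuits over {∧₂,∨₂,0,1} on the
edges of Kₙ with size ≤ n^c eventually whose G(n,1/2)-acceptance probability plus
planted-⌈n^(1/2−δ)⌉-clique rejection probability tends to 0 (monotone circuits of polynomial size
cannot strongly detect planted cliques below √n; the truth is conjecturally n^Θ(δ log n), attained
by guess-and-verify). [difficulty: L] -/
@[route_item "route-PneNP-KarlinRubin"]
def MonotoneBlind : Prop :=
  ∀ δ : ℝ, 0 < δ → δ < 1 / 2 → ∀ c : ℕ, ¬ ∃ C : (n : ℕ) → Literature.Computability.Complexity.Circuit ((⊤ : SimpleGraph (Fin n)).edgeSet), (∀ᶠ n : ℕ in Filter.atTop, (C n).IsOver Literature.Computability.Complexity.monotoneBasis01 ∧ (C n).size ≤ n ^ c) ∧ Filter.Tendsto (fun n : ℕ => (Literature.Probability.RandomGraphs.PlantedClique.erdosRenyiHalf n).toOuterMeasure {x | (C n).eval x = true} + (Literature.Probability.RandomGraphs.PlantedClique.plantedCliqueDist n ⌈(n : ℝ) ^ (1 / 2 - δ)⌉₊).toOuterMeasure {x | (C n).eval x = false}) Filter.atTop (nhds 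0)

/-- item stmt-PneNP-18028 · support · rank 9 · closed · proved by Summit.PneNP.PneNP.Theorems.karlinRubin_erdosRenyiNoLargeClique_proof @ d4d68ebe7160 (prover) · by planner
sources: AlonKrivelevichSudakov1998, BarakHopkinsKelnerKothariMoitraPotechin2019, Jerrum1992
[support] first-moment clique bound for G(n,1/2): if k(n) ≥ (2+η) log₂ n eventually for some η > 0
then Pr[G(n,1/2) has a k(n)-clique] → 0. Verbatim the PROVED item stmt-PneNP-8686 of route
PlantedClique (Theorems/PlantedCliqueErdosRenyiNoLargeClique.lean,
plantedClique_erdosRenyiNoLargeClique_proof); it is the type-I half of the clique test inside the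
deciding theorem. [difficulty: provable-now] -/
@[route_item "route-PneNP-KarlinRubin"]
def ErdosRenyiNoLargeClique : Prop :=
  ∀ k : ℕ → ℕ, (∃ η : ℝ, 0 < η ∧ ∀ᶠ n : ℕ in Filter.atTop, (2 + η) * Real.logb 2 (n : ℝ) ≤ (k n : ℝ)) → Filter.Tendsto (fun n : ℕ => (Literature.Probability.RandomGraphs.PlantedClique.erdosRenyiHalf n).toOuterMeasure {x | ∃ S : Finset (Fin n), S.card = k n ∧ (Literature.Probability.RandomGraphs.PlantedClique.graphOfEdgeVec x).IsClique (S : Set (Fin n))}) Filter.atTop (nhds 0)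

/-- item stmt-PneNP-18051 · support · rank 9 · closed · proved by Summit.PneNP.PneNP.Theorems.cliqueCircuitsOfNotPneNP_proof @ 49a49e456e8b (prover) · by planner
sources: Karp1972, AroraBarak2009
[support] BRIDGE (route-repair rev 1, cone; kind support — does not key staffing): if P = NP in
Cook's sense (¬PneNP) then there is an exponent c such that for all large n and EVERY t ≤ n the
clique function CLIQUE(n, t) of the n(n−1)/2 edge indicators (written inline: `fun x => decide (¬
(SimpleGraph.fromEdgeSet {e | ∃ h, x ⟨e, h⟩ = true}).CliqueFree t)`, rfl-equal to
Literature.Computability.Complexity.cliqueFn n t) has a B₂-circuit with ≤ n^c gates. It is the step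
`¬PneNP ⇒ NP ⊆ P/poly ⇒ polynomial circuits for CLIQUE, uniformly in t ≤ n` of the deciding theorem
`closes : MonotoneSuffices → MonotoneBlind → ErdosRenyiNoLargeClique → CliqueCircuitsOfNotPneNP →
PneNP`, which at rev 0 was IMPORTED from
Summits.PneNP.PneNP.Theorems.ConvexRankGatesCliqueBridgeTerm; that module imports CliqueTestGraphs →
CircuitLowerBounds.lean, the home file of cliqueFn AND of the unproved XL named facts
MurrayWilliams2018_NQP_not_ACC / MurrayWilliams2018_NTIME_not_depth_ACC, which no item of this route
uses (needs-fact: none) but which kept the route unstaffed. Filing the step as an item lets the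
route file import only PlantedClique + Circuit + NegationElimination (11 project modules instead of
107). -/
@[route_item "route-PneNP-KarlinRubin"]
def CliqueCircuitsOfNotPneNP : Prop :=
  ¬ PneNP → ∃ c : ℕ, ∀ᶠ n : ℕ in Filter.atTop, ∀ t : ℕ, t ≤ n → ∃ C : Literature.Computability.Complexity.Circuit ((⊤ : SimpleGraph (Fin n)).edgeSet), C.IsOver Literature.Computability.Complexity.B2 ∧ C.size ≤ n ^ c ∧ C.Computes (fun x => decide (¬ (SimpleGraph.fromEdgeSet {e : Sym2 (Fin n) | ∃ h : e ∈ (⊤ : SimpleGraph (Fin n)).edgeSet, x ⟨e, h⟩ = true}).CliqueFree t))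

-- earlier Assembly (stmt-PneNP-18029, replaced 2026-08-17T07:18:35Z -> stmt-PneNP-18053): retired by None — MonotoneSuffices → MonotoneBlind → ErdosRenyiNoLargeClique → PneNP
/-- item stmt-PneNP-18053 · assembly · rank 1 · closed · moot by None · by planner
sources: Karp1972, arXiv:2501.09545
[assembly] rev 1 (route-repair, cone): MonotoneSuffices → MonotoneBlind → ErdosRenyiNoLargeClique →
CliqueCircuitsOfNotPneNP → PneNP — exactly the type of the natively certified deciding theorem
`closes` (rev 0's Assembly lacked the bridge hypothesis because the bridge was imported from
Summits.PneNP.PneNP.Theorems.ConvexRankGatesCliqueBridgeTerm; it is now the provable-now support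
item CliqueCircuitsOfNotPneNP). Provable by `fun a b c d => closes a b c d` from a Theorems file
importing this route file. [sources: Karp1972, arXiv:2501.09545] -/
@[route_item "route-PneNP-KarlinRubin"]
def Assembly : Prop :=
  MonotoneSuffices → MonotoneBlind → ErdosRenyiNoLargeClique → CliqueCircuitsOfNotPneNP → PneNP

end Summit.PneNP.PneNP.Theses.KarlinRubin
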